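import Summits.MatrixMultiplication.MatrixMultiplication.Theorems.FarEdgeDescentExactSteps
import HarnessLib

/-!
# Far-edge descent, kernel XXXVII-B: the EXACT-LEVEL universal ceiling of product-and-reanchor schedules

Route `FarEdgeDescent`, special leaf `FiniteSaturation` (stmt-MatrixMultiplication-23739): helper
kernel, THESES-FREE and def-free.  Kernel XXXIII proved the ceiling `θ_S = κ/(1−κ) = log(4/3)/log(3/2)
= 0.70951…` (`κ = log₂(4/3)`) for the exact readouts of the SQUARING tower; kernel XXXVI proved it for
EVERY schedule but only at MOMENT level (first-order in `s − 1`, `1 − t`).  This kernel closes the gap: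
the ceiling holds at EXACT level for EVERY product-and-full-reanchor schedule — any DAG whose nodes are
bases from a fixed finite family or products of two earlier nodes, re-anchored cost-free (`Q'' = rr' −
2L''`).  In the normalised exact readout `F = (Q^t + G(s,t))/r` (`G` = the legs' virtual values
`Σ a^s B^t`, `λ = L/r ≤ 1/3` the leg share, `ℓ = log r`, `σ = s − 1`, `τ = 1 − t`):

  `∃ c > 0:  0 ≤ σ ≤ c·τ^κ, 0 < τ ≤ 1  ⟹  F_j ≤ 1 − λ_j/2 < 1  for EVERY node j of EVERY schedule`

(`exact_ceiling`), i.e. every exact readout `Q_j^t + G_j(s,t) ≤ r_j` PASSES with margin `L_j/2` on a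
full wedge of exponent `κ`; hence (`exact_ceiling_powerWorld`, via the abstract `powerWorld_of_wedge`)
the power world `e(k) ≍ k^{−θ_S}` is compatible with every exact certificate of the toolbox, and no
argument using only these readouts proves `RateBeyond θ` for `θ > θ_S`, let alone `FiniteSaturation`.

Mechanism — the dictionary (kernel XXXVII-C, `exact_product_step`): a product step of anchored objects with budgets
`r = Q + 2L`, `r' = Q' + 2L'` has `λ'' = λ + λ' − 3λλ'`, `ℓ'' = ℓ + ℓ'` and, by subadditivity of `x ↦ x^t`
on the new anchor `Q'' = QQ' + 2LL'`, the EXACT STEP INEQUALITY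

  `F'' ≤ F·F' + 2λλ'·min(1, (2LL')^{−τ})`,   `(2LL')^{−τ} ≤ exp(−τ(ℓ'' − Λ))`, `Λ = log(1/(2λ₀²))`,

with equality `F = 1 − λ` throughout at `s = t = 1`.  Writing `F = 1 − λ + X`:
* SHALLOW nodes (`exp(−τ(ℓ−Λ)) > 5/8`, so `ℓ ≲ 1/τ`): `X_j ≤ P(ℓ_j)σ(3λ_j)^{1−κ}ℓ_j^κ` with the potential
  `P(ℓ) = Φ₀exp(CσSℓ^κ) ≤ 2Φ₀` (`shallow_step`).  The linear part is the leg-mass tax of kernel XXXVI-A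
  (`legMass_step`: Hölder + the chord `(1−λ)^pλ' + (1−λ')^pλ ≤ λ''`, `(2/3)^p = 1/2`); the new point is the
  CROSS TERM `XX'`: for COMPARABLE parents (`ℓ_b ≥ ζℓ_a`) it costs a factor `1 + Cσℓ^κ`, summable along
  any path because `ℓ^κ` then grows geometrically (`potential_absorb`, `rpow_comparable`); for UNBALANCED
  parents (`ℓ_b < ζℓ_a`, `ζ^κ = λ₀/2`) the small factor's entire contribution is paid by the contraction
  `1 − λ_b` of the big factor's excess (`lam_rpow_exchange`) — no growth at all.  So `X_j ≤ λ_j/2` as long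
  as `σℓ_j^κ ≲ 1`, i.e. on the wedge `σ ≤ cτ^κ`.
* DEEP nodes (`(2LL')^{−τ} ≤ 5/8`): the margin `F ≤ 1 − λ/2` is HEREDITARY under the exact step with the
  exact constant: `(1−λ/2)(1−λ'/2) + (5/4)λλ' = 1 − λ''/2` (`deep_step`).
* BASE-FED (linear) schedules are blind outright: `F'' ≤ F·F_B + 2λλ_B ≤ 1` whenever the base excess is
  `≤ λ_B/3`, a condition on `σ` alone (`baseFed_blind`) — all certifying power sits in deep × deep products,
  and those are capped at `θ_S`: the structural dichotomy of this leaf, now at exact level.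

* Kernel XXXVII-A (`FarEdgeDescentExactSteps`): the one-step inequalities and `shallow_step`;
  this file: §1 `exactSchedule_invariant` (strong induction over the DAG), `exact_ceiling` (explicit `c`);
  §2 `powerWorld_of_wedge`, `exact_ceiling_powerWorld`; kernel XXXVII-C (`FarEdgeDescentExactDictionary`):
  the dictionary `exact_product_step`, `block_value_le`, and `baseFed_blind`.

References: Schönhage 1981, §5; Pan 1984 (LNCS 179) §16 Props. 16.2–16.5, §17 Thm. 17.1; Stothers 2010,
Thm. 8; Lotti–Romani 1983, Prop. 4.1; Coppersmith–Winograd 1982; Alman–Li 2026, Thm. 5.1 (budget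
`Q + 2L = r`); Hardy–Littlewood–Pólya, Thm. 13 (Hölder).
Tags: `FiniteSaturation` (h₁) NEC · WEAKER · ATTACKED; method ceiling of the exact free-reanchoring
toolbox (BC9-type theorem: it bounds what these certificates prove, not `ω(1,k,1)`).
-/

set_option linter.dupNamespace false

noncomputable section

namespace Summit.MatrixMultiplication.MatrixMultiplication.Theorems.FarEdgeDescentExactCeiling

open Summit.MatrixMultiplication.MatrixMultiplication.Theorems.FarEdgeDescentImprovableRate
open Summit.MatrixMultiplication.MatrixMultiplication.Theorems.FarEdgeDescentAnchorTax
open Summit.MatrixMultiplication.MatrixMultiplication.Theorems.FarEdgeDescentExactSteps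

/-! ## §1 The invariant over an arbitrary schedule and the exact-level ceiling -/

/-- **THE EXACT SCHEDULE INVARIANT** (strong induction over any product-and-reanchor DAG).
Nodes `j` are bases (`λ₀ ≤ λ_j ≤ 1/3`, `0 ≤ ℓ_j`, `ℓ_j^κ ≤ B`, `0 ≤ F_j ≤ 1 − λ_j + Φ₀σ(3λ_j)^{1−κ}ℓ_j^κ`)
or products of two earlier nodes `a, b < j` with full re-anchoring
(`λ_j = λ_a+λ_b−3λ_aλ_b`, `ℓ_j = ℓ_a+ℓ_b`, `0 ≤ F_j ≤ F_aF_b + 2λ_aλ_b·min(1, exp(−τ(ℓ_j−Λ)))`).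
Conclusion, for every node: the MARGIN `F_j ≤ 1 − λ_j/2`, and for SHALLOW nodes
(`exp(−τ(ℓ_j−Λ)) > 5/8`) the potential bound `F_j ≤ 1 − λ_j + Φ₀exp(γℓ_j^κ)σ(3λ_j)^{1−κ}ℓ_j^κ`.
Shallow children come from shallow parents (`shallow_step`); deep children inherit the margin from
any parents (`deep_step`); a shallow node's excess is `≤ (2Cσℓ^κ)λ ≤ λ/2` (`excess_le`, `2CσB ≤ 1/2`).
[cite: Pan1984, Props. 16.2–16.5, Thm. 17.1] [cite: Schonhage1981, §5] [cite: Stothers2010, Thm. 8] -/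
theorem exactSchedule_invariant {κ p l₀ Φ₀ C γ δ ζ σ τ Λ B : ℝ} (lam ℓ F : ℕ → ℝ)
    (hκ0 : 0 < κ) (hκ1 : κ < 1) (hp : p = 1 / (1 - κ)) (h23 : ((2 : ℝ) / 3) ^ p = 1 / 2)
    (hl₀ : 0 < l₀) (hΦ₀ : 0 ≤ Φ₀) (hC0 : 0 ≤ C) (hC : Φ₀ * 3 ^ (1 - κ) ≤ C * l₀ ^ κ) (hσ : 0 ≤ σ)
    (hτ : 0 ≤ τ) (hγ0 : 0 ≤ γ) (hγ : C * σ ≤ γ * δ) (hζ0 : 0 < ζ) (hζ : ζ ^ κ ≤ l₀ / 2)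
    (hδ : 1 + δ ≤ (1 + ζ) ^ κ) (hγB : γ * B ≤ Real.log 2) (hCB : 2 * C * σ * B ≤ 1 / 2)
    (hB : ∀ x : ℝ, 0 ≤ x → 5 / 8 < Real.exp (-(τ * (x - Λ))) → x ^ κ ≤ B)
    (H : ∀ j, (l₀ ≤ lam j ∧ lam j ≤ 1 / 3 ∧ 0 ≤ ℓ j ∧ ℓ j ^ κ ≤ B ∧ 0 ≤ F j ∧
          F j ≤ 1 - lam j + Φ₀ * σ * ((3 * lam j) ^ (1 - κ) * ℓ j ^ κ)) ∨
        (∃ a, a < j ∧ ∃ b, b < j ∧ lam j = lam a + lam b - 3 * lam a * lam b ∧ ℓ j = ℓ a + ℓ b ∧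
          0 ≤ F j ∧ F j ≤ F a * F b + 2 * lam a * lam b ∧
          F j ≤ F a * F b + 2 * lam a * lam b * Real.exp (-(τ * (ℓ j - Λ))))) :
    ∀ j, l₀ ≤ lam j ∧ lam j ≤ 1 / 3 ∧ 0 ≤ ℓ j ∧ 0 ≤ F j ∧ F j ≤ 1 - lam j / 2 ∧
      (5 / 8 < Real.exp (-(τ * (ℓ j - Λ))) →
        F j ≤ 1 - lam j + Φ₀ * Real.exp (γ * ℓ j ^ κ) * σ * ((3 * lam j) ^ (1 - κ) * ℓ j ^ κ)) := by
  -- the excess of a node with ℓ^κ ≤ B is at most half its leg share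
  have hhalf : ∀ {x lm : ℝ}, 0 ≤ x → x ^ κ ≤ B → l₀ ≤ lm →
      Φ₀ * Real.exp (γ * x ^ κ) * σ * ((3 * lm) ^ (1 - κ) * x ^ κ) ≤ lm / 2 := by
    intro x lm hx hxB hlm
    have h1 := excess_le hκ0 hl₀ hΦ₀ hC0 hC hσ hγ0 hx hxB hγB hlm
    have h2 : 2 * C * σ * x ^ κ * lm ≤ 1 / 2 * lm :=
      mul_le_mul_of_nonneg_right (le_trans (mul_le_mul_of_nonneg_left hxB (by positivity)) hCB)
        (le_trans hl₀.le hlm)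
    linarith
  intro j
  induction j using Nat.strong_induction_on with
  | _ j ih => ?_
  rcases H j with ⟨h0, h1, h2, h3, h4, h5⟩ | ⟨a, ha, b, hb, e1, e2, h4, h5, h6⟩
  · -- base node
    have hl : 0 ≤ lam j := le_trans hl₀.le h0
    have hpot : F j ≤ 1 - lam j +
        Φ₀ * Real.exp (γ * ℓ j ^ κ) * σ * ((3 * lam j) ^ (1 - κ) * ℓ j ^ κ) := by
      have hexp : 1 ≤ Real.exp (γ * ℓ j ^ κ) := by
        have : 0 ≤ γ * ℓ j ^ κ := mul_nonneg hγ0 (Real.rpow_nonneg h2 κ)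
        linarith [Real.add_one_le_exp (γ * ℓ j ^ κ)]
      have hR : 0 ≤ Φ₀ * σ * ((3 * lam j) ^ (1 - κ) * ℓ j ^ κ) := by positivity
      have : Φ₀ * σ * ((3 * lam j) ^ (1 - κ) * ℓ j ^ κ) ≤
          Φ₀ * Real.exp (γ * ℓ j ^ κ) * σ * ((3 * lam j) ^ (1 - κ) * ℓ j ^ κ) := by
        calc Φ₀ * σ * ((3 * lam j) ^ (1 - κ) * ℓ j ^ κ)
            = Φ₀ * σ * ((3 * lam j) ^ (1 - κ) * ℓ j ^ κ) * 1 := (mul_one _).symm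
          _ ≤ Φ₀ * σ * ((3 * lam j) ^ (1 - κ) * ℓ j ^ κ) * Real.exp (γ * ℓ j ^ κ) :=
              mul_le_mul_of_nonneg_left hexp hR
          _ = _ := by ring
      linarith
    exact ⟨h0, h1, h2, h4, by linarith [hhalf h2 h3 h0], fun _ => hpot⟩
  · -- product node
    obtain ⟨a0, a1, a2, a3, a4, a5⟩ := ih a ha
    obtain ⟨b0, b1, b2, b3, b4, b5⟩ := ih b hb
    have a0' : 0 ≤ lam a := le_trans hl₀.le a0
    have b0' : 0 ≤ lam b := le_trans hl₀.le b0
    have hw := lam_step a0 a1 b0' b1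
    have hℓj : 0 ≤ ℓ j := by rw [e2]; linarith
    have hshallow : 5 / 8 < Real.exp (-(τ * (ℓ j - Λ))) → F j ≤ 1 - lam j +
        Φ₀ * Real.exp (γ * ℓ j ^ κ) * σ * ((3 * lam j) ^ (1 - κ) * ℓ j ^ κ) := by
      intro hs
      have hsa : 5 / 8 < Real.exp (-(τ * (ℓ a - Λ))) :=
        lt_of_lt_of_le hs (Real.exp_le_exp.2 (by rw [e2]; linarith [mul_nonneg hτ b2]))
      have hsb : 5 / 8 < Real.exp (-(τ * (ℓ b - Λ))) :=
        lt_of_lt_of_le hs (Real.exp_le_exp.2 (by rw [e2]; linarith [mul_nonneg hτ a2]))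
      have pa := a5 hsa
      have pb := b5 hsb
      rcases le_total (ℓ b) (ℓ a) with hba | hab
      · have haB : ℓ a ^ κ ≤ B := hB _ a2 hsa
        have := shallow_step hκ0 hκ1 hp h23 hl₀ hΦ₀ hC0 hC hσ hγ0 hγ hζ0 hζ hδ hγB hCB a0 a1 b0
          b1 b2 hba haB a3 pa b3 pb h5
        rw [e1, e2]; exact this
      · have hbB : ℓ b ^ κ ≤ B := hB _ b2 hsb
        have h5' : F j ≤ F b * F a + 2 * lam b * lam a := by linarith [h5]
        have := shallow_step hκ0 hκ1 hp h23 hl₀ hΦ₀ hC0 hC hσ hγ0 hγ hζ0 hζ hδ hγB hCB b0 b1 a0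
          a1 a2 hab hbB b3 pb a3 pa h5'
        have ew : lam b + lam a - 3 * lam b * lam a = lam a + lam b - 3 * lam a * lam b := by ring
        have eℓ : ℓ b + ℓ a = ℓ a + ℓ b := by ring
        rw [ew, eℓ] at this
        rw [e1, e2]; exact this
    refine ⟨by rw [e1]; exact hw.1, by rw [e1]; exact hw.2, hℓj, h4, ?_, hshallow⟩
    rcases lt_or_ge (5 / 8 : ℝ) (Real.exp (-(τ * (ℓ j - Λ)))) with hs | hd
    · have hjB : ℓ j ^ κ ≤ B := hB _ hℓj hs
      have := hhalf hℓj hjB (show l₀ ≤ lam j by rw [e1]; exact hw.1)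
      linarith [hshallow hs]
    · have := deep_step a0' b0' a3 a4 b3 b4 hd h6
      rw [e1]; exact this

/-- **THE EXACT-LEVEL UNIVERSAL CEILING.**  Fix a finite base family: leg shares `λ_B ≥ λ₀ > 0`,
log-lengths `ℓ_B ≤ ℓ₁`, base census constant `Φ₀` (`F_B ≤ 1 − λ_B + Φ₀σ(3λ_B)^{1−κ}ℓ_B^κ`, `σ = s − 1`)
and `Λ ≥ 0` (`2λλ'rr' ≥ e^{−Λ}rr'`, e.g. `Λ = log(1/(2λ₀²))`).  Then there is `c > 0` such that at every
sub-tangent parameter `(σ, τ) = (s−1, 1−t)` with `0 < τ ≤ 1`, `0 ≤ σ ≤ c·τ^κ`, `κ = log₂(4/3)`, EVERY node of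
EVERY product-and-full-reanchor schedule (any DAG) over the family satisfies `F_j ≤ 1 − λ_j/2 < 1`: its
exact readout `Q_j^t + G_j(s,t) ≤ r_j` PASSES with margin `L_j/2`.  Hence no such schedule excludes any
point of the wedge `s − 1 ≤ c(1−t)^κ`, and the rate ladder built on exact readouts of these schedules is
capped at the order `θ_S = κ/(1−κ) = log(4/3)/log(3/2) = 0.70951…` — the ceiling of kernels XXXIII
(squaring tower) and XXXVI (moment level) now at EXACT level for ALL schedules.
Constants: `ζ = (λ₀/2)^{1/κ}`, `δ = (1+ζ)^κ − 1`, `C = Φ₀3^{1−κ}/λ₀^κ`, `T = Λ + log(8/5)`,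
`c = min(δ log 2, 1/4)/(C(T^κ + ℓ₁^κ) + 1)`.
[cite: Pan1984, Props. 16.2–16.5, Thm. 17.1] [cite: Schonhage1981, §5] [cite: Stothers2010, Thm. 8]
[cite: LottiRomani1983, Prop. 4.1] -/
theorem exact_ceiling {l₀ ℓ₁ Φ₀ Λ : ℝ} (hl₀ : 0 < l₀) (hℓ₁ : 0 ≤ ℓ₁) (hΦ₀ : 0 ≤ Φ₀) (hΛ : 0 ≤ Λ) :
    ∃ c : ℝ, 0 < c ∧ ∀ (σ τ : ℝ) (lam ℓ F : ℕ → ℝ), 0 ≤ σ → 0 < τ → τ ≤ 1 →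
      σ ≤ c * τ ^ Real.logb 2 ((4 : ℝ) / 3) →
      (∀ j, (l₀ ≤ lam j ∧ lam j ≤ 1 / 3 ∧ 0 ≤ ℓ j ∧ ℓ j ≤ ℓ₁ ∧ 0 ≤ F j ∧
            F j ≤ 1 - lam j + Φ₀ * σ * ((3 * lam j) ^ (1 - Real.logb 2 ((4 : ℝ) / 3)) *
              ℓ j ^ Real.logb 2 ((4 : ℝ) / 3))) ∨
          (∃ a, a < j ∧ ∃ b, b < j ∧ lam j = lam a + lam b - 3 * lam a * lam b ∧
            ℓ j = ℓ a + ℓ b ∧ 0 ≤ F j ∧ F j ≤ F a * F b + 2 * lam a * lam b ∧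
            F j ≤ F a * F b + 2 * lam a * lam b * Real.exp (-(τ * (ℓ j - Λ))))) →
      ∀ j, F j ≤ 1 - lam j / 2 := by
  obtain ⟨hκ0, hκ1⟩ := improvableKappa_pos_lt_one
  set κ : ℝ := Real.logb 2 ((4 : ℝ) / 3) with hκ
  have h1κ : 0 < 1 - κ := by linarith
  obtain ⟨p, hp⟩ : ∃ p : ℝ, p = 1 / (1 - κ) := ⟨_, rfl⟩
  have h23 : ((2 : ℝ) / 3) ^ p = 1 / 2 := by rw [hp, hκ, conj_exponent, twoThirds_rpow_conj]
  -- the constants of the schedule-free part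
  obtain ⟨ζ, hζdef⟩ : ∃ ζ : ℝ, ζ = (l₀ / 2) ^ (1 / κ) := ⟨_, rfl⟩
  have hζ0 : 0 < ζ := by rw [hζdef]; exact Real.rpow_pos_of_pos (by positivity) _
  have hζ : ζ ^ κ ≤ l₀ / 2 := by
    rw [hζdef, ← Real.rpow_mul (by positivity), one_div_mul_cancel hκ0.ne', Real.rpow_one]
  obtain ⟨δ, hδdef⟩ : ∃ δ : ℝ, δ = (1 + ζ) ^ κ - 1 := ⟨_, rfl⟩
  have hδ0 : 0 < δ := by rw [hδdef, sub_pos]; exact Real.one_lt_rpow (by linarith) hκ0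
  have hδ : 1 + δ ≤ (1 + ζ) ^ κ := by rw [hδdef]; linarith
  have hl₀κ : 0 < l₀ ^ κ := Real.rpow_pos_of_pos hl₀ κ
  obtain ⟨C, hCdef⟩ : ∃ C : ℝ, C = Φ₀ * 3 ^ (1 - κ) / l₀ ^ κ := ⟨_, rfl⟩
  have hC0 : 0 ≤ C := by rw [hCdef]; positivity
  have hC : Φ₀ * 3 ^ (1 - κ) ≤ C * l₀ ^ κ := by rw [hCdef, div_mul_cancel₀ _ hl₀κ.ne']
  obtain ⟨T, hTdef⟩ : ∃ T : ℝ, T = Λ + Real.log (8 / 5) := ⟨_, rfl⟩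
  have hlog85 : 0 < Real.log (8 / 5 : ℝ) := Real.log_pos (by norm_num)
  have hT0 : 0 < T := by rw [hTdef]; linarith
  obtain ⟨W, hWdef⟩ : ∃ W : ℝ, W = T ^ κ + ℓ₁ ^ κ := ⟨_, rfl⟩
  have hW0 : 0 ≤ W := by rw [hWdef]; positivity
  have hlog2 : 0 < Real.log 2 := Real.log_pos (by norm_num)
  have hmin0 : 0 < min (δ * Real.log 2) (1 / 4) := lt_min (by positivity) (by norm_num)
  have hCW1 : 0 < C * W + 1 := by positivity
  obtain ⟨c, hcdef⟩ : ∃ c : ℝ, c = min (δ * Real.log 2) (1 / 4) / (C * W + 1) := ⟨_, rfl⟩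
  have hc0 : 0 < c := by rw [hcdef]; positivity
  refine ⟨c, hc0, ?_⟩
  intro σ τ lam ℓ F hσ hτ hτ1 hστ H j
  -- the shallow-length bound B and the two smallness conditions at (σ, τ)
  have hTτ : 0 ≤ T / τ := by positivity
  obtain ⟨B, hBdef⟩ : ∃ B : ℝ, B = (T / τ) ^ κ + ℓ₁ ^ κ := ⟨_, rfl⟩
  have hB1 : ℓ₁ ^ κ ≤ B := by rw [hBdef]; linarith [Real.rpow_nonneg hTτ κ]
  have hBnn : 0 ≤ B := le_trans (Real.rpow_nonneg hℓ₁ κ) hB1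
  have hB : ∀ x : ℝ, 0 ≤ x → 5 / 8 < Real.exp (-(τ * (x - Λ))) → x ^ κ ≤ B := by
    intro x hx hs
    have h1 : Real.log (5 / 8) < -(τ * (x - Λ)) := by
      by_contra hcon
      push Not at hcon
      have h := Real.exp_le_exp.2 hcon
      rw [Real.exp_log (by norm_num)] at h
      linarith
    have h85 : Real.log (5 / 8 : ℝ) = -Real.log (8 / 5) := by
      rw [← Real.log_inv]; norm_num
    have hτΛ : τ * Λ ≤ Λ := mul_le_of_le_one_left hΛ hτ1
    have h2 : x * τ ≤ T := by rw [hTdef]; nlinarith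
    have h3 : x ≤ T / τ := by rw [le_div_iff₀ hτ]; exact h2
    have h4 : x ^ κ ≤ (T / τ) ^ κ := Real.rpow_le_rpow hx h3 hκ0.le
    rw [hBdef]; linarith [Real.rpow_nonneg hℓ₁ κ]
  have hτκ1 : τ ^ κ ≤ 1 := Real.rpow_le_one hτ.le hτ1 hκ0.le
  have hσB : σ * B ≤ c * W := by
    have e0 : τ * (T / τ) = T := by field_simp
    have e1 : τ ^ κ * (T / τ) ^ κ = T ^ κ := by rw [← Real.mul_rpow hτ.le hTτ, e0]
    have hℓ₁κ : 0 ≤ ℓ₁ ^ κ := Real.rpow_nonneg hℓ₁ κ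
    calc σ * B ≤ c * τ ^ κ * B := mul_le_mul_of_nonneg_right hστ hBnn
      _ = c * (τ ^ κ * (T / τ) ^ κ + τ ^ κ * ℓ₁ ^ κ) := by rw [hBdef]; ring
      _ = c * (T ^ κ + τ ^ κ * ℓ₁ ^ κ) := by rw [e1]
      _ ≤ c * (T ^ κ + ℓ₁ ^ κ) := by
          apply mul_le_mul_of_nonneg_left _ hc0.le
          linarith [mul_le_of_le_one_left hℓ₁κ hτκ1]
      _ = c * W := by rw [hWdef]
  have hcW : C * (c * W) ≤ min (δ * Real.log 2) (1 / 4) := by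
    have e : C * (c * W) = min (δ * Real.log 2) (1 / 4) * (C * W) / (C * W + 1) := by
      rw [hcdef]; ring
    rw [e, div_le_iff₀ hCW1]
    exact mul_le_mul_of_nonneg_left (by linarith) hmin0.le
  have hCσB : C * σ * B ≤ min (δ * Real.log 2) (1 / 4) := by
    calc C * σ * B = C * (σ * B) := by ring
      _ ≤ C * (c * W) := mul_le_mul_of_nonneg_left hσB hC0
      _ ≤ _ := hcW
  obtain ⟨γ, hγdef⟩ : ∃ γ : ℝ, γ = C * σ / δ := ⟨_, rfl⟩
  have hγ0 : 0 ≤ γ := by rw [hγdef]; positivity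
  have hγ : C * σ ≤ γ * δ := by rw [hγdef, div_mul_cancel₀ _ hδ0.ne']
  have hγB : γ * B ≤ Real.log 2 := by
    have e : γ * B = C * σ * B / δ := by rw [hγdef]; ring
    rw [e, div_le_iff₀ hδ0]
    calc C * σ * B ≤ min (δ * Real.log 2) (1 / 4) := hCσB
      _ ≤ δ * Real.log 2 := min_le_left _ _
      _ = Real.log 2 * δ := mul_comm _ _
  have hCB : 2 * C * σ * B ≤ 1 / 2 := by
    have := le_trans hCσB (min_le_right _ _)
    linarith
  -- feed the invariant
  have H' : ∀ j, (l₀ ≤ lam j ∧ lam j ≤ 1 / 3 ∧ 0 ≤ ℓ j ∧ ℓ j ^ κ ≤ B ∧ 0 ≤ F j ∧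
        F j ≤ 1 - lam j + Φ₀ * σ * ((3 * lam j) ^ (1 - κ) * ℓ j ^ κ)) ∨
      (∃ a, a < j ∧ ∃ b, b < j ∧ lam j = lam a + lam b - 3 * lam a * lam b ∧ ℓ j = ℓ a + ℓ b ∧
        0 ≤ F j ∧ F j ≤ F a * F b + 2 * lam a * lam b ∧
        F j ≤ F a * F b + 2 * lam a * lam b * Real.exp (-(τ * (ℓ j - Λ)))) := by
    intro i
    rcases H i with ⟨h0, h1, h2, h3, h4, h5⟩ | hstep
    · exact Or.inl ⟨h0, h1, h2, le_trans (Real.rpow_le_rpow h2 h3 hκ0.le) hB1, h4, h5⟩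
    · exact Or.inr hstep
  exact (exactSchedule_invariant lam ℓ F hκ0 hκ1 hp h23 hl₀ hΦ₀ hC0 hC hσ hτ.le hγ0 hγ hζ0 hζ hδ
    hγB hCB hB H' j).2.2.2.2.1

/-! ## §2 Consequence: the power world of order `θ_S` passes every exact readout of every schedule -/

/-- **Wedge ⟹ the power world of order `θ_S = κ/(1−κ)` passes** (the abstract form of kernel
XXXIII-B `readout_of_powerWorld`).  If a property `Pass(s,t)` holds at every `1 ≤ s`, `0 ≤ t < 1` with
`s − 1 ≤ c(1−t)^κ`, then there is `M > 0` such that every `(s,t)` sub-tangent to the model profile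
`x ↦ x + 1 + M·x^{−κ/(1−κ)}` has `Pass(s,t)` (evaluate the sub-tangent inequality at
`x = (c/2)(1−t)^{κ−1}`). [cite: Pan1984, Thm. 17.1] [cite: LottiRomani1983, Prop. 4.1] -/
theorem powerWorld_of_wedge {κ c : ℝ} (hκ0 : 0 < κ) (hκ1 : κ < 1) (hc : 0 < c)
    (Pass : ℝ → ℝ → Prop)
    (hW : ∀ s t : ℝ, 1 ≤ s → 0 ≤ t → t < 1 → s - 1 ≤ c * (1 - t) ^ κ → Pass s t) :
    ∃ M : ℝ, 0 < M ∧ ∀ s t : ℝ, 1 ≤ s → 0 ≤ t → t < 1 →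
      (∀ x : ℝ, 0 < x → s + x * t ≤ x + 1 + M * x ^ (-(κ / (1 - κ)))) → Pass s t := by
  obtain ⟨θ, hθ⟩ : ∃ θ : ℝ, θ = κ / (1 - κ) := ⟨_, rfl⟩
  have hθ0 : 0 < θ := by rw [hθ]; exact div_pos hκ0 (by linarith)
  rw [← hθ]
  have hl0 : 0 < c / 2 := by positivity
  refine ⟨c / 2 * (c / 2) ^ θ, by positivity, ?_⟩
  intro s t hs1 ht0 ht1 hsub
  have hτ : 0 < 1 - t := by linarith
  have hx : 0 < c / 2 * (1 - t) ^ (κ - 1) := mul_pos hl0 (Real.rpow_pos_of_pos hτ _)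
  have h := hsub _ hx
  have e1 : c / 2 * (1 - t) ^ (κ - 1) * (1 - t) = c / 2 * (1 - t) ^ κ := by
    rw [mul_assoc, ← Real.rpow_add_one hτ.ne', sub_add_cancel]
  have h1κ : (1 : ℝ) - κ ≠ 0 := (sub_pos.2 hκ1).ne'
  have eθ : (κ - 1) * -θ = κ := by
    rw [hθ]
    field_simp
    ring
  have e2 : c / 2 * (c / 2) ^ θ * (c / 2 * (1 - t) ^ (κ - 1)) ^ (-θ) = c / 2 * (1 - t) ^ κ := by
    rw [Real.mul_rpow hl0.le (Real.rpow_nonneg hτ.le _), ← Real.rpow_mul hτ.le, eθ,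
      Real.rpow_neg hl0.le]
    have hp : (c / 2) ^ θ ≠ 0 := (Real.rpow_pos_of_pos hl0 θ).ne'
    field_simp
  refine hW s t hs1 ht0 ht1 ?_
  have key : s - 1 ≤ c / 2 * (1 - t) ^ (κ - 1) * (1 - t) +
      c / 2 * (c / 2) ^ θ * (c / 2 * (1 - t) ^ (κ - 1)) ^ (-θ) := by
    nlinarith
  rw [e1, e2] at key
  linarith

/-- **THE POWER WORLD OF ORDER EXACTLY `θ_S` PASSES EVERY EXACT READOUT OF EVERY SCHEDULE.**  For a
base family as in `exact_ceiling` there is `M > 0` such that at every `(s,t)` (`1 ≤ s`, `0 ≤ t < 1`)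
sub-tangent to the model profile `x ↦ x + 1 + M·x^{−θ_S}`, `θ_S = log(4/3)/log(3/2) = 0.70951…`, every node
of every product-and-full-reanchor schedule over the family passes with margin: `F_j ≤ 1 − λ_j/2`.  An excess
`e(k) = ω(1,k,1) − (k+1) ≍ k^{−θ_S}` is therefore compatible with EVERY exact readout the toolbox (any DAG
of products with cost-free re-anchoring over a finite base family) can produce: the order of the method is
`θ_S` at exact level, not only for the squaring tower (XXXIII) or at moment level (XXXVI).  This is a
METHOD CEILING (BC9-type): it bounds what these certificates can prove, not `ω(1,k,1)` itself.
[cite: Pan1984, Thm. 17.1] [cite: Schonhage1981, §5] [cite: Stothers2010, Thm. 8] [cite: LottiRomani1983, Prop. 4.1] -/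
theorem exact_ceiling_powerWorld {l₀ ℓ₁ Φ₀ Λ : ℝ} (hl₀ : 0 < l₀) (hℓ₁ : 0 ≤ ℓ₁) (hΦ₀ : 0 ≤ Φ₀)
    (hΛ : 0 ≤ Λ) :
    ∃ M : ℝ, 0 < M ∧ ∀ s t : ℝ, 1 ≤ s → 0 ≤ t → t < 1 →
      (∀ x : ℝ, 0 < x → s + x * t ≤ x + 1 +
        M * x ^ (-(Real.logb 2 ((4 : ℝ) / 3) / (1 - Real.logb 2 ((4 : ℝ) / 3))))) →
      ∀ (lam ℓ F : ℕ → ℝ),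
        (∀ j, (l₀ ≤ lam j ∧ lam j ≤ 1 / 3 ∧ 0 ≤ ℓ j ∧ ℓ j ≤ ℓ₁ ∧ 0 ≤ F j ∧
              F j ≤ 1 - lam j + Φ₀ * (s - 1) * ((3 * lam j) ^ (1 - Real.logb 2 ((4 : ℝ) / 3)) *
                ℓ j ^ Real.logb 2 ((4 : ℝ) / 3))) ∨
            (∃ a, a < j ∧ ∃ b, b < j ∧ lam j = lam a + lam b - 3 * lam a * lam b ∧
              ℓ j = ℓ a + ℓ b ∧ 0 ≤ F j ∧ F j ≤ F a * F b + 2 * lam a * lam b ∧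
              F j ≤ F a * F b + 2 * lam a * lam b * Real.exp (-((1 - t) * (ℓ j - Λ))))) →
        ∀ j, F j ≤ 1 - lam j / 2 := by
  obtain ⟨c, hc, hcl⟩ := exact_ceiling hl₀ hℓ₁ hΦ₀ hΛ
  obtain ⟨hκ0, hκ1⟩ := improvableKappa_pos_lt_one
  obtain ⟨M, hM, h⟩ := powerWorld_of_wedge hκ0 hκ1 hc
    (fun s t => ∀ (lam ℓ F : ℕ → ℝ),
        (∀ j, (l₀ ≤ lam j ∧ lam j ≤ 1 / 3 ∧ 0 ≤ ℓ j ∧ ℓ j ≤ ℓ₁ ∧ 0 ≤ F j ∧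
              F j ≤ 1 - lam j + Φ₀ * (s - 1) * ((3 * lam j) ^ (1 - Real.logb 2 ((4 : ℝ) / 3)) *
                ℓ j ^ Real.logb 2 ((4 : ℝ) / 3))) ∨
            (∃ a, a < j ∧ ∃ b, b < j ∧ lam j = lam a + lam b - 3 * lam a * lam b ∧
              ℓ j = ℓ a + ℓ b ∧ 0 ≤ F j ∧ F j ≤ F a * F b + 2 * lam a * lam b ∧
              F j ≤ F a * F b + 2 * lam a * lam b * Real.exp (-((1 - t) * (ℓ j - Λ))))) →
        ∀ j, F j ≤ 1 - lam j / 2)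
    (fun s t hs ht0 ht1 hw lam ℓ F H j =>
      hcl (s - 1) (1 - t) lam ℓ F (by linarith) (by linarith) (by linarith) hw H j)
  exact ⟨M, hM, fun s t hs ht0 ht1 hsub lam ℓ F H j => h s t hs ht0 ht1 hsub lam ℓ F H j⟩

end Summit.MatrixMultiplication.MatrixMultiplication.Theorems.FarEdgeDescentExactCeiling

end
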